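import Summits.NavierStokesRegularity.FluidComputer.ClayBlowupConcentration
import Summits.NavierStokesRegularity.FluidComputer.DesignedBlowupFarField
import Literature.Analysis.FluidPDE.CKNEpsilonRegularityLemma142Holds
import HarnessLib

/-!
# The self-similar scale is attained in every backward cylinder at a singular point:
# `|u| > c/r` or `|p_N| > (c/r)²` somewhere in `Q_r(T, x₀)`, for all small `r`

Cell `ns-blowup`, seat `ns-blowup-ecbridge-2` (g6; the E–C endpoint theory seat). LABEL: E–C typing
(KERNEL — no named fact). WHAT THIS IS NOT: not Navier–Stokes evidence — a necessary condition on the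
TYPES `ClayBlowup ν` / `DesignedBlowup ν` (no inhabitant is claimed anywhere). Companion memo:
`run/shared/lean/pub/ns-blowup/ecbridge2/ECBRIDGE-2-MEMO-5.md` §2 (row R6‴).

## Content

The pointwise reading of CKN concentration (`ClayBlowup.ckn_concentration`: at a singular point `x₀` of
the final slice, `∫∫_{Q_r(T,x₀)} (|u|³ + |p_N|^{3/2}) > ε³ r²` for all `0 < r ≤ r₁`): since
`|Q_r| = |B₁| r⁵`, the integrand cannot be `≤ 2(c/r)³` throughout `Q_r(T, x₀)` once `2 c³ |B₁| ≤ ε³`.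

* `ClayBlowup.selfSimilar_scale_attained` — there are `c, r₁ > 0` such that at every singular point
  `x₀` and every scale `0 < r ≤ r₁` some `(t, x) ∈ Q_r(T, x₀) = (T - r², T) × B(x₀, r)` has
  `‖u(t, x)‖ > c / r` OR `|p_N(t, x)| > (c / r)²` (`p_N = p̃[u] + Δ⁻¹∇·f`): the velocity or the
  normalised pressure reaches the self-similar (Leray) scale arbitrarily close to `(T, x₀)` inside the
  parabolic cone of aperture `1` — the localized form, with pressure alternative, of Leray's rate
  `‖u(t)‖_∞ ≳ (T - t)^{-1/2}` (tree: `ClayBlowup.not_subTypeI` / `exists_norm_gt_near`).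
* `DesignedBlowup.ckn_concentration`, `DesignedBlowup.selfSimilar_scale_attained` — the same rows on the
  designed type (what the construction lanes certify), along `DesignedBlowup.toClayBlowup`.

References: L. Caffarelli, R. Kohn, L. Nirenberg, CPAM 35 (1982), Prop. 1 / Cor. 1
[cite: CaffarelliKohnNirenberg1982, Prop. 1]; P. G. Lemarié-Rieusset (2016), Thm. 14.4 (p. 505)
[cite: LemarieRieusset2016, Thm. 14.4]; J. Leray, Acta Math. 63 (1934), §34 (3.13)
[cite: Leray1934, §34]; C. L. Fefferman, Clay problem description, (C) [cite: FeffermanClay2006, (C)].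
-/

noncomputable section

namespace Summit.NavierStokesRegularity.FluidComputer

open Set MeasureTheory Filter Topology Function TopologicalSpace Metric
open scoped ENNReal ContDiff NNReal
open Literature.Analysis.FluidPDE
open Summit.NavierStokesRegularity.NavierStokesRegularity
open Summit.NavierStokesRegularity.FluidComputer.PalasekTowerClayBridge

namespace ClayBlowup

variable {ν : ℝ} (X : ClayBlowup ν)

/-- **If `|u| ≤ a` and `|p_N| ≤ a²` on `Q_r(T, x₀)` then `∫∫_{Q_r(T,x₀)} (|u|³ + |p_N|^{3/2}) ≤ 2 a³ |B₁| r⁵`**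
(`|Q_r| = r² · |B₁| r³`). [folklore] -/
theorem lintegral_cylinder_le_of_bounds {x₀ : EuclideanSpace ℝ (Fin 3)} {r a : ℝ} (hr : 0 < r)
    (ha : 0 ≤ a)
    (hu : ∀ z ∈ parabolicCylinder r ((X.T : ℝ), x₀), ‖X.u z.1 z.2‖ ≤ a)
    (hp : ∀ z ∈ parabolicCylinder r ((X.T : ℝ), x₀),
      ‖normalisedPressure (X.u z.1) z.2 + forcePotential (X.f z.1) z.2‖ ≤ a ^ 2) :
    ∫⁻ z in parabolicCylinder r ((X.T : ℝ), x₀),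
        (‖X.u z.1 z.2‖ₑ ^ (3 : ℕ) +
          ‖normalisedPressure (X.u z.1) z.2 + forcePotential (X.f z.1) z.2‖ₑ ^ (3 / 2 : ℝ)) ≤
      ENNReal.ofReal (2 * a ^ 3 * (volume (ball (0 : EuclideanSpace ℝ (Fin 3)) 1)).toReal * r ^ 5) := by
  set V₁e : ℝ≥0∞ := volume (ball (0 : EuclideanSpace ℝ (Fin 3)) 1) with hV₁e
  have hV₁top : V₁e ≠ ⊤ := measure_ball_lt_top.ne
  have hV₁eq : V₁e = ENNReal.ofReal V₁e.toReal := (ENNReal.ofReal_toReal hV₁top).symm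
  have hpt : ∀ z ∈ parabolicCylinder r ((X.T : ℝ), x₀),
      ‖X.u z.1 z.2‖ₑ ^ (3 : ℕ) +
          ‖normalisedPressure (X.u z.1) z.2 + forcePotential (X.f z.1) z.2‖ₑ ^ (3 / 2 : ℝ) ≤
        ENNReal.ofReal (2 * a ^ 3) := by
    intro z hz
    have h1 : ‖X.u z.1 z.2‖ₑ ^ (3 : ℕ) ≤ ENNReal.ofReal (a ^ 3) := by
      rw [← ofReal_norm, ← ENNReal.ofReal_pow (norm_nonneg _)]
      exact ENNReal.ofReal_le_ofReal (pow_le_pow_left₀ (norm_nonneg _) (hu z hz) 3)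
    have h2 : ‖normalisedPressure (X.u z.1) z.2 + forcePotential (X.f z.1) z.2‖ₑ ^ (3 / 2 : ℝ) ≤
        ENNReal.ofReal (a ^ 3) := by
      rw [← ofReal_norm, ENNReal.ofReal_rpow_of_nonneg (norm_nonneg _) (by norm_num),
        ← Lemma142.sq_rpow_three_halves ha]
      exact ENNReal.ofReal_le_ofReal (Real.rpow_le_rpow (norm_nonneg _) (hp z hz) (by norm_num))
    calc _ ≤ ENNReal.ofReal (a ^ 3) + ENNReal.ofReal (a ^ 3) := add_le_add h1 h2
      _ = ENNReal.ofReal (2 * a ^ 3) := by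
          rw [← ENNReal.ofReal_add (by positivity) (by positivity)]; ring_nf
  have hvol : volume (parabolicCylinder r ((X.T : ℝ), x₀)) =
      ENNReal.ofReal (r ^ 2) * (ENNReal.ofReal (r ^ 3) * V₁e) := by
    rw [parabolicCylinder, Measure.volume_eq_prod, Measure.prod_prod, Real.volume_Ioo,
      Measure.addHaar_ball_of_pos _ _ hr, finrank_euclideanSpace_fin]
    congr 2
    ring
  calc _ ≤ ∫⁻ _ in parabolicCylinder r ((X.T : ℝ), x₀), ENNReal.ofReal (2 * a ^ 3) :=
        setLIntegral_mono' (isOpen_parabolicCylinder _ _).measurableSet hpt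
    _ = ENNReal.ofReal (2 * a ^ 3) * (ENNReal.ofReal (r ^ 2) * (ENNReal.ofReal (r ^ 3) * V₁e)) := by
        rw [setLIntegral_const, hvol]
    _ = ENNReal.ofReal (2 * a ^ 3 * V₁e.toReal * r ^ 5) := by
        rw [hV₁eq, ENNReal.toReal_ofReal ENNReal.toReal_nonneg, ← ENNReal.ofReal_mul (by positivity),
          ← ENNReal.ofReal_mul (by positivity), ← ENNReal.ofReal_mul (by positivity)]
        congr 1
        ring

/-- **THE SELF-SIMILAR SCALE IS ATTAINED IN EVERY BACKWARD CYLINDER AT A SINGULAR POINT.** For a Clay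
blow-up at `ν > 0` there are `c > 0`, `r₁ > 0` such that at every singular point `x₀` of the final
slice (`¬ IsBackwardBoundedAt u T x₀`) and every scale `0 < r ≤ r₁`, some `(t, x)` with
`T - r² < t < T`, `|x - x₀| < r` has `‖u(t, x)‖ > c / r` or `|p_N(t, x)| > (c / r)²`
(`p_N = p̃[u] + Δ⁻¹∇·f`). CKN concentration (`ckn_concentration`) against the volume `|B₁| r⁵` of the
cylinder. No named fact. [cite: CaffarelliKohnNirenberg1982, Prop. 1] [cite: Leray1934, §34 (3.13)] -/
theorem selfSimilar_scale_attained (hν : 0 < ν) :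
    ∃ c r₁ : ℝ, 0 < c ∧ 0 < r₁ ∧ ∀ x₀ : EuclideanSpace ℝ (Fin 3), ¬ IsBackwardBoundedAt X.u X.T x₀ →
      ∀ r : ℝ, 0 < r → r ≤ r₁ → ∃ z ∈ parabolicCylinder r ((X.T : ℝ), x₀),
        c / r < ‖X.u z.1 z.2‖ ∨
          (c / r) ^ 2 < ‖normalisedPressure (X.u z.1) z.2 + forcePotential (X.f z.1) z.2‖ := by
  obtain ⟨ε, r₁, hε, hr₁, hconc⟩ := X.ckn_concentration hν
  set V₁ : ℝ := (volume (ball (0 : EuclideanSpace ℝ (Fin 3)) 1)).toReal with hV₁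
  have hV₁0 : 0 ≤ V₁ := ENNReal.toReal_nonneg
  -- `c = ε / (2 V₁ + 2)`: then `2 c³ V₁ ≤ ε³`
  set c : ℝ := ε / (2 * V₁ + 2) with hc
  have hden : 1 ≤ 2 * V₁ + 2 := by linarith
  have hc0 : 0 < c := div_pos hε (by linarith)
  have hcε : c ≤ ε := by
    rw [hc, div_le_iff₀ (by linarith)]
    nlinarith
  have hkey : 2 * c ^ 3 * V₁ ≤ ε ^ 3 := by
    have h1 : c ^ 3 ≤ c ^ 2 * ε := by
      rw [pow_succ]
      exact mul_le_mul_of_nonneg_left hcε (sq_nonneg _)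
    have h2 : c * (2 * V₁ + 2) = ε := by rw [hc]; field_simp
    calc 2 * c ^ 3 * V₁ ≤ c ^ 3 * (2 * V₁ + 2) := by nlinarith [pow_pos hc0 3]
      _ = c ^ 2 * (c * (2 * V₁ + 2)) := by ring
      _ = c ^ 2 * ε := by rw [h2]
      _ ≤ ε ^ 2 * ε := by gcongr
      _ = ε ^ 3 := by ring
  refine ⟨c, r₁, hc0, hr₁, fun x₀ hx₀ r hr hrr₁ => ?_⟩
  by_contra hall
  push Not at hall
  have hcr : 0 ≤ c / r := div_nonneg hc0.le hr.le
  have hle := X.lintegral_cylinder_le_of_bounds hr hcr (fun z hz => (hall z hz).1)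
    (fun z hz => (hall z hz).2)
  have hlt := hconc x₀ hx₀ r hr hrr₁
  have hreal : 2 * (c / r) ^ 3 * V₁ * r ^ 5 ≤ ε ^ 3 * r ^ 2 := by
    rw [div_pow]
    have hr3 : r ^ 3 ≠ 0 := pow_ne_zero 3 hr.ne'
    calc 2 * (c ^ 3 / r ^ 3) * V₁ * r ^ 5 = 2 * c ^ 3 * V₁ * r ^ 2 := by field_simp
      _ ≤ ε ^ 3 * r ^ 2 := by gcongr
  exact absurd (hlt.trans_le (hle.trans (ENNReal.ofReal_le_ofReal hreal))) (lt_irrefl _)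

end ClayBlowup

namespace DesignedBlowup

variable {ν : ℝ} (D : DesignedBlowup ν)

/-- **CKN concentration at the singular points of a designed blow-up** (`ν > 0`): at every singular
point `x₀` of the final slice and every `0 < r ≤ r₁`, `∫∫_{Q_r(T,x₀)} (|u|³ + |p_N|^{3/2}) > ε³ r²`
(`ClayBlowup.ckn_concentration` along `toClayBlowup`). No named fact.
[cite: CaffarelliKohnNirenberg1982, Prop. 1] -/
theorem ckn_concentration (hν : 0 < ν) :
    ∃ ε r₁ : ℝ, 0 < ε ∧ 0 < r₁ ∧ ∀ x₀ : EuclideanSpace ℝ (Fin 3), ¬ IsBackwardBoundedAt D.u D.T x₀ →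
      ∀ r : ℝ, 0 < r → r ≤ r₁ →
        ENNReal.ofReal (ε ^ 3 * r ^ 2) <
          ∫⁻ z in parabolicCylinder r ((D.T : ℝ), x₀),
            (‖D.u z.1 z.2‖ₑ ^ (3 : ℕ) +
              ‖normalisedPressure (D.u z.1) z.2 + forcePotential (D.f z.1) z.2‖ₑ ^ (3 / 2 : ℝ)) :=
  D.toClayBlowup.ckn_concentration hν

/-- **The self-similar scale is attained in every backward cylinder at a singular point of a designed
blow-up** (`ν > 0`; `ClayBlowup.selfSimilar_scale_attained` along `toClayBlowup`). No named fact.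
[cite: CaffarelliKohnNirenberg1982, Prop. 1] [cite: Leray1934, §34 (3.13)] -/
theorem selfSimilar_scale_attained (hν : 0 < ν) :
    ∃ c r₁ : ℝ, 0 < c ∧ 0 < r₁ ∧ ∀ x₀ : EuclideanSpace ℝ (Fin 3), ¬ IsBackwardBoundedAt D.u D.T x₀ →
      ∀ r : ℝ, 0 < r → r ≤ r₁ → ∃ z ∈ parabolicCylinder r ((D.T : ℝ), x₀),
        c / r < ‖D.u z.1 z.2‖ ∨
          (c / r) ^ 2 < ‖normalisedPressure (D.u z.1) z.2 + forcePotential (D.f z.1) z.2‖ :=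
  D.toClayBlowup.selfSimilar_scale_attained hν

end DesignedBlowup

end Summit.NavierStokesRegularity.FluidComputer

end
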